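/-
Copyright: lit-balaban Phase-2 proof seat p30 (gen 6).  Statement-level skeleton of a published paper; no proof claims beyond what
the kernel checks below.
-/
import Literature.MathematicalPhysics.QuantumFieldTheory.BalabanImbrieJaffe1984to88.BIJ85Eq611Torus
import Literature.MathematicalPhysics.QuantumFieldTheory.BalabanImbrieJaffe1984to88.BIJ85Prop522Torus

/-!
# `BalabanImbrieJaffe1984to88.BIJ85Eq611Landau` — T. Bałaban, J. Imbrie, A. Jaffe, *Renormalization of the Higgs model: minimizers,
propagators and the stability of mean field theory*, Commun. Math. Phys. **97** (1985) 299–329 [BalabanImbrieJaffe1985]: Sect. 6.1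
**(6.1.1) σ_k = σ_{k+1} + Fluctuation Form ON THE TORI, WITH THE LANDAU-GAUGE MINIMIZER `H_k` OF (4.4.2)** — the printed `H_k` of
(6.1.4)–(6.1.8) (*"H_k in place of H_{k,Ax}"*) is seat p11's linear operator `BIJ85Prop522Torus.HkE` (the constrained Landau minimizer
(4.4.2) `BIJ85LandauMinimizer442.Hk` packaged as a linear map), the gauge-invariance input (6.1.4) `∂H_{k,Ax} = ∂H_k` is the torus theorem
`BIJ85Prop522Torus.curlOp_comp_HaxE` ((5.2.8)), and `C^{(k)}` is the operator `BIJ85Prop522Torus.CE` of (4.3.3)/(4.4.4); so (6.1.1) holds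
on the tori with the translation (6.1.8) `B = B′ + L^{−d/2}C^{(k)}H_k^*∂^*Q^{e*}_{k+1}f^{(k+1)}` written with EXACTLY the printed objects, no
hypothesis beyond the standing range `k + 1 ≤ m + K`, `c ≠ 0`, `w = η^d > 0`, `2 ≤ d`

statement-level skeleton of published theorems with citation tags; proofs where landed; nothing here is a claim about the Yang–Mills mass gap

PDF held: `paper:balaban1985-cmp97-bij-higgs-minimizers` (journal page = PDF page + 298).  Pages read as images: pp. 318–319
[PDF 20–21] (`HOME/lit-balaban-r15/pages/1985-cmp97-bij-higgs-minimizers-p020-x2.png`, `…-p021-x2.png`), pp. 312, 316.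

CITATION HEADER (lean-in-tree rule).  Part of the lit-balaban TYPED SKELETON (HOME `run/shared/lean/pub/lit-balaban/`), Phase-2
seat p30 (gen 6), unit `lit-balaban-p30`; WHAT IS REPRODUCED = rows **C1.Eq6.1.1** and **C1.Eq6.1.2-6.1.9** (member (6.1.4)) of
`HOME/SKELETON.md` (reader file `HOME/lit-balaban-r15/ROWS-C1.md`) AT THE TORUS MODEL OF RECORD with the Landau minimizer: gen 5's
`BIJ85Eq611Torus.eq611_torus` ((6.1.1) on the tori for ANY linear `H_k` obeying (6.1.4)) with its last hypothesis `h614` DISCHARGED for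
`H_k :=` (4.4.2).

THE PRINTED TEXT (p. 318–319 [PDF 20–21], verbatim): *"The goal here is to show that ⟨f^{(k)}, σ_k f^{(k)}⟩ = 𝒮_L^{−1}⟨f^{(k+1)}, σ_{k+1}
f^{(k+1)}⟩ + ⟨B, Δ_kB⟩. (6.1.1)"*; *"Now we use gauge invariance in the form of the statement ∂H_{k,Ax} = ∂H_k, (6.1.4) which follows by
Proposition 5.1.1. Thus we can use H_k in place of H_{k,Ax}, …"*; *"Define B by B′ = B − L^{−d/2}C^{(k)}H_k^*∂^*Q^{e*}_{k+1}f^{(k+1)}. (6.1.8)"*;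
p. 312: *"Let H_kB denote the Landau gauge minimizer, … (4.4.2)"*; p. 316: *"the fact that H^*_{j,Ax}∂^* = H_j^*∂^*, (5.2.8) is gauge invariant"*.

THE TORUS DATA (as in `BIJ85Eq611Torus`): η-bond fields `BondSpace P`, η-plaquette fields `PlaqSpace P`, `∂ = curlOp w c` (`w = η^d`,
`c = η⁻¹`), the constraint subspaces `V411 P j` = δ(Q_jA)δ_{j,Ax}(A), unit bond fields `CoarseSpace P k` with `Q^{s*}_k = QsE P k`, the
fluctuation constraint `Wstep P k` = δ(QB′)δ_{Ax}(B′), unit plaquette fields `UnitPlaqSpace P k`, `Q^{e*}_k = QesOp hd w k`, `σ_k = sigmaTorus hd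
w c k` ((4.2.1)–(4.2.2)), the unit-lattice curl `dOne P k c` and the one-step `Q^{e*}` `QesOne P hd k` of (6.4), `Δ_k = deltaOp …` ((4.3.1)),
`H_{k,Ax}` = `Hop …` (p09) = `HaxE P w c k` (p11) (`HaxE_eq_Hop`), `H_k = HkE P w c k` ((4.4.2)), `C^{(k)} = CE P w c k` ((4.3.3); = p09's
`unitPropagator`, `CE_eq_unitPropagator`).

WHAT IS PROVED: `HaxE_eq_Hop`, `CE_eq_unitPropagator` (the two packagings of `H_{k,Ax}` and of `C^{(k)}` in the tree agree — p09's union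
bridges `BIJ85Prop521Proof.Hop_eq_HaxOp`/`unitPropagator_eq`); **`eq614_landau`** = (6.1.4) `∂H_k = ∂H_{k,Ax}` for the Landau `H_k` as the
operator identity gen 5's `eq611_torus` consumes (p11's `curlOp_comp_HaxE`); `transl618_landau_eq_axial` ((5.2.8) ⇒ the translation
(6.1.8) is the same vector whether written with `H_k^*` or with `H^*_{k,Ax}`); **`eq611_landau`** = (6.1.1) ON THE TORI WITH THE LANDAU
`H_k` AND `C^{(k)} = CE`, hypothesis-free in the standing range; `eq611_landau_L` (factor written `L^{−d}`), `eq611_landau_deltaTorus` (the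
fluctuation term is gen 3's torus action `deltaTorus`), `eq611_landau_rescaled` (the printed 𝒮_L form: right member in the (k+1)-st step's
weight `L^{−d}w`, `BIJ85SigmaTorusScaling.scaling_absorbs`).  D-0026: theorems only, no `def`, no new named fact.  Unit `lit-balaban-p30`
(literature-prover-lit-balaban-p30-g6-0), 2026-08-21.
-/

open scoped BigOperators RealInnerProductSpace

namespace Literature.MathematicalPhysics.QuantumFieldTheory.BalabanImbrieJaffe1984to88.BIJ85Eq611Landau

open Literature.MathematicalPhysics.QuantumFieldTheory.Balaban1983to89
open LatticeFieldCalculus BIJ85AxialPropagator411 BIJ85SigmaForm421 BIJ85UnitPropagator433 BIJ85Prop521Proof BIJ85Prop521Torus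
  BIJ85Sigma421Torus BIJ85Eq611Torus BIJ85Prop522Torus BIJ85SigmaTorusScaling

noncomputable section

variable {P : Params}

/-! ## 1. The two packagings of `H_{k,Ax}` and of `C^{(k)}` agree; (6.1.4) for the Landau minimizer -/

/-- `H_{k,Ax}` as a linear map of the unit-lattice field: seat p11's `HaxE P w c k` (= p30's `HaxOp` at the torus data) IS seat p09's `Hop`
at the torus data (the union bridge `BIJ85Prop521Proof.Hop_eq_HaxOp`). [cite: BalabanImbrieJaffe1985, (4.1.3) p.310] -/
theorem HaxE_eq_Hop (w c : ℝ) (k : ℕ) :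
    HaxE P w c k = Hop (V411 P k) (curlOp (P := P) w c) (QsE P k) :=
  (Hop_eq_HaxOp _ _ _).symm

/-- `C^{(k)}` of (4.3.3): seat p11's `CE P w c k` (`axialPropagator (Wstep P k) (∂ ∘ H_{k,Ax})`) IS seat p09's `unitPropagator` at the torus
data (the union bridge `BIJ85Prop521Proof.unitPropagator_eq`). [cite: BalabanImbrieJaffe1985, (4.3.3) p.311] -/
theorem CE_eq_unitPropagator (w c : ℝ) (k : ℕ) :
    CE P w c k = unitPropagator (V411 P k) (curlOp (P := P) w c) (QsE P k) (Wstep P k) := by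
  rw [unitPropagator_eq]; rfl

/-- **(6.1.4) FOR THE LANDAU MINIMIZER ON THE TORI** p. 319 [PDF 21], verbatim: *"Now we use gauge invariance in the form of the statement
∂H_{k,Ax} = ∂H_k, (6.1.4) which follows by Proposition 5.1.1."* — as the operator identity `∂ ∘ H_k = ∂ ∘ H_{k,Ax}` between the Euclidean
spaces, with `H_k = HkE P w c k` the Landau-gauge minimizer (4.4.2) (a linear operator, `BIJ85Prop522Torus.HkE_apply`) and `H_{k,Ax} = Hop …`;
seat p11's `curlOp_comp_HaxE` (from p30 gen 4's configuration form `BIJ85Prop511Torus.eq528_torus` of Proposition 5.1.1/(5.2.8)); standing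
range `k ≤ m + K`, `c ≠ 0`, `w > 0`. [cite: BalabanImbrieJaffe1985, (6.1.4) p.319] -/
theorem eq614_landau {k : ℕ} (hk : k ≤ P.m + P.K) {c : ℝ} (hc : c ≠ 0) {w : ℝ} (hw : 0 < w) :
    curlOp (P := P) w c ∘ₗ HkE P w c k = curlOp (P := P) w c ∘ₗ Hop (V411 P k) (curlOp (P := P) w c) (QsE P k) := by
  rw [← HaxE_eq_Hop]
  exact (curlOp_comp_HaxE hk hc hw).symm

/-- **(5.2.8) ⇒ the translation (6.1.8) does not see the gauge**: `C^{(k)}H_k^*∂^*g = C^{(k)}H^*_{k,Ax}∂^*g` for every plaquette source `g`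
(p. 316 *"H^*_{j,Ax}∂^* = H_j^*∂^*, (5.2.8)"*, seat p11's `eq528_torus_adjoint`), so the fluctuation field `B` of (6.1.8) is the same vector
whether the Landau or the axial minimizer is used. [cite: BalabanImbrieJaffe1985, (5.2.8) p.316] -/
theorem transl618_landau_eq_axial {k : ℕ} (hk : k ≤ P.m + P.K) {c : ℝ} (hc : c ≠ 0) {w : ℝ} (hw : 0 < w) (g : PlaqSpace P) :
    CE P w c k (LinearMap.adjoint (HkE P w c k) (LinearMap.adjoint (curlOp (P := P) w c) g)) =
      CE P w c k (LinearMap.adjoint (HaxE P w c k) (LinearMap.adjoint (curlOp (P := P) w c) g)) := by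
  have h := LinearMap.congr_fun (eq528_torus_adjoint hk hc hw) g
  simp only [LinearMap.coe_comp, Function.comp_apply] at h
  rw [h]

/-! ## 2. (6.1.1) on the tori with the Landau `H_k` -/

/-- **(6.1.1) ON THE TORI WITH THE LANDAU-GAUGE MINIMIZER `H_k`** p. 318 [PDF 20], verbatim: *"⟨f^{(k)}, σ_k f^{(k)}⟩ = 𝒮_L^{−1}⟨f^{(k+1)},
σ_{k+1} f^{(k+1)}⟩ + ⟨B, Δ_kB⟩. (6.1.1)"* with (6.1.8) *"B′ = B − L^{−d/2}C^{(k)}H_k^*∂^*Q^{e*}_{k+1}f^{(k+1)}"* and p. 319 *"we can use H_k in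
place of H_{k,Ax}"* — for the torus forms σ_k = `sigmaTorus hd w c k`, σ_{k+1} = `sigmaTorus hd w c (k+1)` (same η-lattice; 𝒮_L^{−1}⟨·,·⟩ =
l²⟨·,·⟩, l = L^{−d/2}, as in gen 1/gen 5), Δ_k = `deltaOp` at the torus data, f^{(k)} = ∂B′ + lQ^{e*}f^{(k+1)} ((6.4): `dOne`, `QesOne`), B′ in
δ(QB′)δ_{Ax}(B′) = `Wstep P k`, and B = B′ + lC^{(k)}H_k^*∂^*Q^{e*}_{k+1}f^{(k+1)} with **`H_k = HkE P w c k` the Landau minimizer (4.4.2)** and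
**`C^{(k)} = CE P w c k`** ((4.3.3)/(4.4.4)).  Gen 5's `eq611_torus` with its hypothesis (6.1.4) discharged by `eq614_landau`; every other
printed input already discharged there ((4.2.2), (4.3.1), (5.3.1), (5.2.1), Prop A3 (A15)–(A16), no zero modes, the constraint tower,
∂Q^{s*}_k = Q^{e*}_k∂, Q^{e*}_kQ^{e*} = Q^{e*}_{k+1}); standing range `k + 1 ≤ m + K`, `c ≠ 0`, `w = η^d > 0`, `2 ≤ d`.
[cite: BalabanImbrieJaffe1985, (6.1.1) p.318] -/
theorem eq611_landau (hd : 2 ≤ P.d) {k : ℕ} (hk : k + 1 ≤ P.m + P.K) {c : ℝ} (hc : c ≠ 0) {w : ℝ} (hw : 0 < w)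
    (l : ℝ) (fL : UnitPlaqSpace P (k + 1)) (B' : CoarseSpace P k) (hB' : B' ∈ Wstep P k) :
    ⟪dOne P k c B' + l • QesOne P hd k fL, sigmaTorus (P := P) hd w c k (dOne P k c B' + l • QesOne P hd k fL)⟫ =
      l ^ 2 * ⟪fL, sigmaTorus (P := P) hd w c (k + 1) fL⟫
      + ⟪B' + l • CE P w c k
            (LinearMap.adjoint (HkE P w c k) (LinearMap.adjoint (curlOp (P := P) w c) (QesOp (P := P) hd w (k + 1) fL))),
         deltaOp (V411 P k) (curlOp (P := P) w c) (QsE P k)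
           (B' + l • CE P w c k
            (LinearMap.adjoint (HkE P w c k) (LinearMap.adjoint (curlOp (P := P) w c) (QesOp (P := P) hd w (k + 1) fL))))⟫ := by
  rw [CE_eq_unitPropagator]
  exact eq611_torus hd hk hc hw (HkE P w c k) (eq614_landau (by omega) hc hw) l fL B' hB'

/-- **(6.1.1) on the tori, Landau `H_k`, factor written `L^{−d}`** (p. 319: *"the scaling 𝒮_L absorbs the factor L^{−d}"*): `l = L^{−d/2} =
(√L)^{−d}`, `l² = L^{−d}`. [cite: BalabanImbrieJaffe1985, (6.1.1) p.318] -/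
theorem eq611_landau_L (hd : 2 ≤ P.d) {k : ℕ} (hk : k + 1 ≤ P.m + P.K) {c : ℝ} (hc : c ≠ 0) {w : ℝ} (hw : 0 < w)
    (fL : UnitPlaqSpace P (k + 1)) (B' : CoarseSpace P k) (hB' : B' ∈ Wstep P k) :
    let l : ℝ := (Real.sqrt (P.L : ℝ))⁻¹ ^ P.d
    ⟪dOne P k c B' + l • QesOne P hd k fL, sigmaTorus (P := P) hd w c k (dOne P k c B' + l • QesOne P hd k fL)⟫ =
      ((P.L : ℝ) ^ P.d)⁻¹ * ⟪fL, sigmaTorus (P := P) hd w c (k + 1) fL⟫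
      + ⟪B' + l • CE P w c k
            (LinearMap.adjoint (HkE P w c k) (LinearMap.adjoint (curlOp (P := P) w c) (QesOp (P := P) hd w (k + 1) fL))),
         deltaOp (V411 P k) (curlOp (P := P) w c) (QsE P k)
           (B' + l • CE P w c k
            (LinearMap.adjoint (HkE P w c k) (LinearMap.adjoint (curlOp (P := P) w c) (QesOp (P := P) hd w (k + 1) fL))))⟫ := by
  intro l
  have hL : (0 : ℝ) < (P.L : ℝ) := by have := P.hL.2; positivity
  have hl : l ^ 2 = ((P.L : ℝ) ^ P.d)⁻¹ := by
    show ((Real.sqrt (P.L : ℝ))⁻¹ ^ P.d) ^ 2 = _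
    rw [← pow_mul, mul_comm, pow_mul, inv_pow, Real.sq_sqrt hL.le, inv_pow]
  rw [← hl]
  exact eq611_landau hd hk hc hw l fL B' hB'

/-- **The fluctuation term of (6.1.1) with the Landau `H_k` is the torus action (4.3.1)–(4.3.2)** `⟨B, Δ_kB⟩ = deltaTorus w c k B =
Σ_pη^d|(∂H_{k,Ax}B)(p)|²` (gen 3's `BIJ85Sigma421Torus.deltaTorus`, gen 5's `inner_deltaOp_torus`) of the Landau-translated fluctuation field.
[cite: BalabanImbrieJaffe1985, (6.1.1) p.318] -/
theorem eq611_landau_deltaTorus (hd : 2 ≤ P.d) {k : ℕ} (hk : k + 1 ≤ P.m + P.K) {c : ℝ} (hc : c ≠ 0) {w : ℝ} (hw : 0 < w)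
    (l : ℝ) (fL : UnitPlaqSpace P (k + 1)) (B' : CoarseSpace P k) (hB' : B' ∈ Wstep P k) :
    ⟪dOne P k c B' + l • QesOne P hd k fL, sigmaTorus (P := P) hd w c k (dOne P k c B' + l • QesOne P hd k fL)⟫ =
      l ^ 2 * ⟪fL, sigmaTorus (P := P) hd w c (k + 1) fL⟫
      + deltaTorus w c k ((toEj P k).symm
          (B' + l • CE P w c k
            (LinearMap.adjoint (HkE P w c k) (LinearMap.adjoint (curlOp (P := P) w c) (QesOp (P := P) hd w (k + 1) fL))))) := by
  rw [← inner_deltaOp_torus (by omega) hc hw]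
  exact eq611_landau hd hk hc hw l fL B' hB'

/-- **(6.1.1) IN THE PRINTED 𝒮_L FORM, ON THE TORI, LANDAU `H_k`** p. 318–319: the right member read in the (k+1)-st step's own normalization,
`l²·⟨f, σ_{k+1}f⟩_w = ⟨f, σ_{k+1}f⟩_{l²w}` (`BIJ85SigmaTorusScaling.scaling_absorbs`; the torus σ is linear in the weight `w = η^d` and independent of
the curl factor, so any `c′ ≠ 0` may be used at level k+1): `⟨f^{(k)}, σ_k^{(w,c)}f^{(k)}⟩ = ⟨f^{(k+1)}, σ_{k+1}^{(l²w,c′)}f^{(k+1)}⟩ + ⟨B, Δ_kB⟩` with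
B = (6.1.8) written with the Landau `H_k` and `C^{(k)} = CE`; `k + 1 ≤ m + K`, `c, c′, l ≠ 0`, `w > 0`, `2 ≤ d`. [cite: BalabanImbrieJaffe1985, (6.1.1) p.318] -/
theorem eq611_landau_rescaled (hd : 2 ≤ P.d) {k : ℕ} (hk : k + 1 ≤ P.m + P.K) {c c' : ℝ} (hc : c ≠ 0) (hc' : c' ≠ 0) {w : ℝ}
    (hw : 0 < w) {l : ℝ} (hl : l ≠ 0) (fL : UnitPlaqSpace P (k + 1)) (B' : CoarseSpace P k) (hB' : B' ∈ Wstep P k) :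
    ⟪dOne P k c B' + l • QesOne P hd k fL, sigmaTorus (P := P) hd w c k (dOne P k c B' + l • QesOne P hd k fL)⟫ =
      ⟪fL, sigmaTorus (P := P) hd (l ^ 2 * w) c' (k + 1) fL⟫
      + ⟪B' + l • CE P w c k
            (LinearMap.adjoint (HkE P w c k) (LinearMap.adjoint (curlOp (P := P) w c) (QesOp (P := P) hd w (k + 1) fL))),
         deltaOp (V411 P k) (curlOp (P := P) w c) (QsE P k)
           (B' + l • CE P w c k
            (LinearMap.adjoint (HkE P w c k) (LinearMap.adjoint (curlOp (P := P) w c) (QesOp (P := P) hd w (k + 1) fL))))⟫ := by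
  rw [← scaling_absorbs hd hk hw hc hc' hl fL]
  exact eq611_landau hd hk hc hw l fL B' hB'

/-- The same with the printed numbers: `l = L^{−d/2}`, `l² = L^{−d}`, the weight of the (k+1)-st step `L^{−d}·w` (`= (η/L)^d` for `w = η^d`),
Landau `H_k`. [cite: BalabanImbrieJaffe1985, (6.1.1) p.319] -/
theorem eq611_landau_rescaled_L (hd : 2 ≤ P.d) {k : ℕ} (hk : k + 1 ≤ P.m + P.K) {c c' : ℝ} (hc : c ≠ 0) (hc' : c' ≠ 0) {w : ℝ}
    (hw : 0 < w) (fL : UnitPlaqSpace P (k + 1)) (B' : CoarseSpace P k) (hB' : B' ∈ Wstep P k) :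
    let l : ℝ := (Real.sqrt (P.L : ℝ))⁻¹ ^ P.d
    ⟪dOne P k c B' + l • QesOne P hd k fL, sigmaTorus (P := P) hd w c k (dOne P k c B' + l • QesOne P hd k fL)⟫ =
      ⟪fL, sigmaTorus (P := P) hd (((P.L : ℝ) ^ P.d)⁻¹ * w) c' (k + 1) fL⟫
      + ⟪B' + l • CE P w c k
            (LinearMap.adjoint (HkE P w c k) (LinearMap.adjoint (curlOp (P := P) w c) (QesOp (P := P) hd w (k + 1) fL))),
         deltaOp (V411 P k) (curlOp (P := P) w c) (QsE P k)
           (B' + l • CE P w c k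
            (LinearMap.adjoint (HkE P w c k) (LinearMap.adjoint (curlOp (P := P) w c) (QesOp (P := P) hd w (k + 1) fL))))⟫ := by
  intro l
  have hL : (0 : ℝ) < (P.L : ℝ) := by have := P.hL.2; positivity
  have hl0 : l ≠ 0 := pow_ne_zero _ (inv_ne_zero (Real.sqrt_pos.2 hL).ne')
  have hl : l ^ 2 = ((P.L : ℝ) ^ P.d)⁻¹ := by
    show ((Real.sqrt (P.L : ℝ))⁻¹ ^ P.d) ^ 2 = _
    rw [← pow_mul, mul_comm, pow_mul, inv_pow, Real.sq_sqrt hL.le, inv_pow]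
  rw [← hl]
  exact eq611_landau_rescaled hd hk hc hc' hw hl0 fL B' hB'

/-- **"Thus we can use H_k in place of H_{k,Ax}"** (p. 319): the two readings of (6.1.1) on the tori — gen 5's `eq611_torus_ax` (B translated
with `H^*_{k,Ax}`, `C^{(k)}` = p09's `unitPropagator`) and `eq611_landau` (B translated with the Landau `H_k^*`, `C^{(k)} = CE`) — have THE SAME
fluctuation field `B` ((5.2.8), `transl618_landau_eq_axial`). [cite: BalabanImbrieJaffe1985, (6.1.8) p.319] -/
theorem transl618_landau_eq_unitPropagator {k : ℕ} (hk : k ≤ P.m + P.K) {c : ℝ} (hc : c ≠ 0) {w : ℝ} (hw : 0 < w)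
    (l : ℝ) (B' : CoarseSpace P k) (g : PlaqSpace P) :
    B' + l • CE P w c k (LinearMap.adjoint (HkE P w c k) (LinearMap.adjoint (curlOp (P := P) w c) g)) =
      B' + l • unitPropagator (V411 P k) (curlOp (P := P) w c) (QsE P k) (Wstep P k)
        (LinearMap.adjoint (Hop (V411 P k) (curlOp (P := P) w c) (QsE P k)) (LinearMap.adjoint (curlOp (P := P) w c) g)) := by
  rw [transl618_landau_eq_axial hk hc hw, CE_eq_unitPropagator, HaxE_eq_Hop]

end

end Literature.MathematicalPhysics.QuantumFieldTheory.BalabanImbrieJaffe1984to88.BIJ85Eq611Landau
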